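import Mathlib
import HarnessLib
import Summits.AtomisticToContinuum.Crystallization.Statement
import Summits.AtomisticToContinuum.Crystallization.Theses.HcpThetaUniversality

/-!
# Birth skeleton — crux `Target` (stmt-AtomisticToContinuum-5558) of route `HcpThetaUniversality`

BC3 skeleton (registrar one-shot, 2026-08-17). The crux `Target` is the route's thesis
`X = X₁ ∧ X₂ ∧ X₃ ∧ X₄`: by `Iff.rfl` (refuter rreview-81cd395a, grounder g18-9) it is the conjunction of
the four ranked crux decls of the route, bodies inlined in this order:

* `X₁ = HcpThetaMaxPackings` (rank 2, stmt-5056) — Θ-PACK: hcp maximises every Gaussian pair sum among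
  finite unit packings of `ℝ³`;
* `X₂ = LjGroundStatesNearInvSixMax` (rank 4, stmt-5058) — LJ TRANSFER: cleaned, rescaled LJ ground states
  are unit packings within `1/20` per particle of hcp's `r⁻⁶` lattice sum;
* `X₃ = NearMaxGroundStatesCrystallize` (rank 3, stmt-5057) — RIGIDITY ENDGAME: `1/20`-near-maximal
  `r⁻⁶` packers among LJ ground states ⇒ `IsCrystallizing lennardJones 3`;
* `X₄ = CrysPeriodicMinAttained` (rank 5, shared stmt-0627) — the periodic LJ minimum is attained.

So the honest skeleton of `Target` has exactly these four stubs (each an OPEN route item, none derivable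
from the others, none implying `Target` or the sub-problem `Crystallization` on its own — BC3 probes in
the registrar's folder `bc/Target_probe.lean`), and the assembly `Target_of` is the anonymous
constructor (the same term that proves the route's frame item `TargetGlue`, stmt-14147, landed as
`Summit.AtomisticToContinuum.Crystallization.Theorems.hcpThetaUniversality_targetGlue_proof`).
Each stub is stated BY NAME of its route decl, so proving a stub and closing the corresponding
route item are the same act; `Target` itself then closes by bookkeeping.

Sorries: exactly four, one per `stub_*`; `Target_of` is sorry-free.
-/

namespace Summit.AtomisticToContinuum.Crystallization.Cruxes.Target.Birth

open Summit.AtomisticToContinuum.Crystallization.Theses.HcpThetaUniversality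

/-- stub X₁ (rank-2 crux `HcpThetaMaxPackings`, stmt-AtomisticToContinuum-5056): for every `t > 0` and every
finite unit packing `x : Fin N → ℝ³`, `Σ_i Σ_{j ≠ i} e^{-t·dist(x_i,x_j)²} ≤ N · θ_hcp(t)`. -/
theorem stub_hcpThetaMaxPackings :
    Summit.AtomisticToContinuum.Crystallization.Theses.HcpThetaUniversality.HcpThetaMaxPackings := by
  sorry

/-- stub X₂ (rank-4 crux `LjGroundStatesNearInvSixMax`, stmt-AtomisticToContinuum-5058): eventually in `N`,
LJ ground states cleaned of `≤ N/1000` particles and rescaled by `c ∈ [1, 53/50]` are unit packings whose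
`r⁻⁶` double sum is `≥ #S · (L₆(hcp) − 1/20)`. -/
theorem stub_ljGroundStatesNearInvSixMax :
    Summit.AtomisticToContinuum.Crystallization.Theses.HcpThetaUniversality.LjGroundStatesNearInvSixMax := by
  sorry

/-- stub X₃ (rank-3 crux `NearMaxGroundStatesCrystallize`, stmt-AtomisticToContinuum-5057): if LJ ground
states are (after the same cleaning/rescaling) within `1/20` per particle of the `r⁻⁶` supremum over ALL
finite unit packings, then `IsCrystallizing lennardJones 3`. -/
theorem stub_nearMaxGroundStatesCrystallize :
    Summit.AtomisticToContinuum.Crystallization.Theses.HcpThetaUniversality.NearMaxGroundStatesCrystallize := by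
  sorry

/-- stub X₄ (rank-5 crux `CrysPeriodicMinAttained`, shared stmt-AtomisticToContinuum-0627): some periodic
configuration of `ℝ³` attains the infimum of the LJ energy per particle over periodic configurations. -/
theorem stub_crysPeriodicMinAttained :
    Summit.AtomisticToContinuum.Crystallization.Theses.HcpThetaUniversality.CrysPeriodicMinAttained := by
  sorry

/-- ASSEMBLY (sorry-free): the four stubs give the crux `Target` BY NAME — `Target` is by definition the
conjunction of their four bodies in this order, so the proof is the anonymous constructor. -/
theorem Target_of :
    Summit.AtomisticToContinuum.Crystallization.Theses.HcpThetaUniversality.HcpThetaMaxPackings →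
    Summit.AtomisticToContinuum.Crystallization.Theses.HcpThetaUniversality.LjGroundStatesNearInvSixMax →
    Summit.AtomisticToContinuum.Crystallization.Theses.HcpThetaUniversality.NearMaxGroundStatesCrystallize →
    Summit.AtomisticToContinuum.Crystallization.Theses.HcpThetaUniversality.CrysPeriodicMinAttained →
    Summit.AtomisticToContinuum.Crystallization.Theses.HcpThetaUniversality.Target := by
  intro h₁ h₂ h₃ h₄
  exact ⟨h₁, h₂, h₃, h₄⟩

/-- The skeleton instantiated: `Target` from the four (sorried) stubs through `Target_of`. -/
theorem Target_skeleton :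
    Summit.AtomisticToContinuum.Crystallization.Theses.HcpThetaUniversality.Target :=
  Target_of stub_hcpThetaMaxPackings stub_ljGroundStatesNearInvSixMax
    stub_nearMaxGroundStatesCrystallize stub_crysPeriodicMinAttained

end Summit.AtomisticToContinuum.Crystallization.Cruxes.Target.Birth
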